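import Literature.NumberTheory.Automorphic.SLTwoTreeProjectiveActionAdj         -- ★ B-p08 (g28) (W1c)-A part 2: adjacency for `|det g| ∈ {1, |ϖ|}`
import Mathlib.Algebra.Order.Group.End                                            -- `Group (G ≃g G)` (`RelIso.instGroup`)
import HarnessLib

/-!
# The action of `GL₂(F)` on the tree of `SL₂(F)` through `PGL₂(F)`, III: every `g` is a graph automorphism — `glTreeIso g : X ≃g X` and the
# homomorphism `glTreeHom : GL₂(F) →* (X ≃g X)` (Serre, *Trees*, Ch. II §1.2–§1.3)

Topic `NumberTheory/Automorphic`; namespace `Literature.NumberTheory.Automorphic.HermitianLatticeTree`.  Two DEFINITIONS (`glTreeIso`, `glTreeHom`) and their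
`rfl`-API; no instance, no notation, no named fact, no `sorry`.  Cell `pub/hodgecm-mathlib` (D-0151), crux H413 = `stmt-HodgeConjecture-24833`, line «N6nsGerm»,
residue «R2EP-wild» of `stub_N6nsR2EP : RankOneEulerPoincareNonsplit`, ROAD W brick (W1c)-A part 3 (census `B-provers/B-p08/g28/CENSUS-W1c-W2-TreeAction.B-p08g28.md`;
consumer: B-p14 (g32)'s (W3)+(W4)-generic head `TreeAction.natCard_fixedBy_add_eq_natCard_fixedBy_add_one_of_treeAction (act : Γ →* (G ≃g G)) …`).
HONEST LABEL: HC_CM is proved only modulo the cell's 2 remaining named inputs (hLiu418, h413) until rung 0 closes; nothing printed is asserted here.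

THE MATHEMATICS.  `X = latticeTree (RingHom.id F) ϖ J`, `J = (0 1; −1 0)`, is the tree of `SL₂(F)` (★ (W0) `isTree_latticeTree_id_altJ`); `g · M := glVertexAct g M` is the
special representative of the class of `gM` (★ part 1).  Writing `det g = ϖ^m · e` (`e` a unit) and `g = (ϖ^{⌊m∕2⌋} · 1) · g′`, the homothety is invisible
(★ `glVertexAct_scalar_mul`) and `|det g′| ∈ {1, |ϖ|}`, where ★ part 2 proved that adjacency is preserved; with `g⁻¹` this is an `iff`, so `g ↦ (M ↦ g · M)` is a
homomorphism `GL₂(F) →* Aut(X)` killing the centre.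
* §1 `exists_eq_scalar_mul_valuation_det` (the factorisation), **`latticeTree_adj_glVertexAct`**, `latticeTree_adj_glVertexAct_iff`;
* §2 **`glTreeIso`**, `glTreeIso_apply`, **`glTreeHom`**, `glTreeHom_apply`, `glTreeHom_scalar_mul`, `glTreeHom_scalar` (the centre acts trivially).

## References
* [Serre1980Trees] J.-P. Serre, *Trees* (1980), Ch. II §1.2–§1.3 (`GL₂`, `SL₂`, `PGL₂` acting on the tree; `Aut(X)`).
* [Kottwitz1988] R. E. Kottwitz, *Tamagawa numbers*, Ann. of Math. 127 (1988), §2 (the group acts on its building; Euler–Poincaré functions).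
-/

set_option autoImplicit false

noncomputable section

open scoped ValuativeRel Matrix MatrixGroups
open Matrix ValuativeRel

namespace Literature.NumberTheory.Automorphic.HermitianLatticeTree

variable {F : Type*} [Field F] [ValuativeRel F] {ϖ : F} (hϖ : IsUniformizingElement ϖ) [IsDiscreteValuationRing 𝒪[F]]

/-! ## §1 Every `g ∈ GL₂(F)` preserves adjacency -/

include hϖ in
/-- **FACTORISATION THROUGH THE CENTRE**: every `g ∈ GL₂(F)` is `(c · 1) · g′` with `c = ϖ^{⌊ord det g ∕ 2⌋}` and `|det g′| ∈ {1, |ϖ|}`.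
[cite: Serre1980Trees, Ch. II §1.2] -/
theorem exists_eq_scalar_mul_valuation_det (g : GL (Fin 2) F) :
    ∃ (c : Fˣ) (g' : GL (Fin 2) F),
      g = c.map ((Matrix.scalar (Fin 2) : F →+* Matrix (Fin 2) (Fin 2) F) : F →* Matrix (Fin 2) (Fin 2) F) * g' ∧
      (valuation F (g' : Matrix (Fin 2) (Fin 2) F).det = 1 ∨ valuation F (g' : Matrix (Fin 2) (Fin 2) F).det = valuation F ϖ) := by
  have h0 := hϖ.ne_zero
  have hv0 : valuation F ϖ ≠ 0 := (Valuation.ne_zero_iff _).2 h0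
  have hdet0 : (g : Matrix (Fin 2) (Fin 2) F).det ≠ 0 := (g.isUnit.map Matrix.detMonoidHom).ne_zero
  obtain ⟨m, u, hu, hm⟩ := exists_eq_zpow_mul_of_ne_zero hϖ hdet0
  set c : Fˣ := (Units.mk0 ϖ h0) ^ (m / 2) with hc
  have hcval : (c : F) = ϖ ^ (m / 2) := by rw [hc, Units.val_zpow_eq_zpow_val, Units.val_mk0]
  set S : F →* Matrix (Fin 2) (Fin 2) F := ((Matrix.scalar (Fin 2) : F →+* Matrix (Fin 2) (Fin 2) F) : F →* Matrix (Fin 2) (Fin 2) F) with hS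
  refine ⟨c, (c.map S)⁻¹ * g, by rw [mul_inv_cancel_left], ?_⟩
  have hval : (((c.map S)⁻¹ * g : GL (Fin 2) F) : Matrix (Fin 2) (Fin 2) F) = ((c : F)⁻¹) • (g : Matrix (Fin 2) (Fin 2) F) := by
    rw [← map_inv, Units.val_mul, Units.coe_map, Units.val_inv_eq_inv_val, hS, MonoidHom.coe_coe, Matrix.scalar_apply,
      ← Matrix.smul_eq_diagonal_mul]
  have key : valuation F ((((c.map S)⁻¹ * g : GL (Fin 2) F) : Matrix (Fin 2) (Fin 2) F)).det = valuation F ϖ ^ (m % 2) := by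
    rw [hval, valuation_det_smul, hcval, hm, map_mul, hu, mul_one, map_inv₀, map_zpow₀, map_zpow₀, ← zpow_natCast, ← _root_.zpow_neg,
      ← _root_.zpow_mul, ← zpow_add₀ hv0]
    congr 1
    omega
  rw [key]
  rcases Int.emod_two_eq_zero_or_one m with h | h
  · exact Or.inl (by rw [h, zpow_zero])
  · exact Or.inr (by rw [h, zpow_one])

include hϖ in
/-- **EVERY `g ∈ GL₂(F)` PRESERVES ADJACENCY** of the tree of `SL₂(F)` (reduce to `|det g′| ∈ {1, |ϖ|}` through the centre, ★ parts 1–2).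
[cite: Serre1980Trees, Ch. II §1.2–§1.3] -/
theorem latticeTree_adj_glVertexAct (g : GL (Fin 2) F)
    {M N : {M : Submodule 𝒪[F] (Fin 2 → F) // IsSpecialLattice (RingHom.id F) ϖ !![(0 : F), 1; -1, 0] M}}
    (hMN : (latticeTree (RingHom.id F) ϖ !![(0 : F), 1; -1, 0]).Adj M N) :
    (latticeTree (RingHom.id F) ϖ !![(0 : F), 1; -1, 0]).Adj (glVertexAct hϖ g M) (glVertexAct hϖ g N) := by
  obtain ⟨c, g', rfl, hdet⟩ := exists_eq_scalar_mul_valuation_det hϖ g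
  rw [glVertexAct_scalar_mul, glVertexAct_scalar_mul]
  rcases hdet with h | h
  · exact latticeTree_adj_glVertexAct_of_valuation_det_eq_one hϖ h hMN
  · exact latticeTree_adj_glVertexAct_of_valuation_det_eq hϖ h hMN

include hϖ in
/-- … and reflects it (apply the previous statement to `g⁻¹`). [cite: Serre1980Trees, Ch. II §1.2–§1.3] -/
theorem latticeTree_adj_glVertexAct_iff (g : GL (Fin 2) F)
    (M N : {M : Submodule 𝒪[F] (Fin 2 → F) // IsSpecialLattice (RingHom.id F) ϖ !![(0 : F), 1; -1, 0] M}) :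
    (latticeTree (RingHom.id F) ϖ !![(0 : F), 1; -1, 0]).Adj (glVertexAct hϖ g M) (glVertexAct hϖ g N) ↔
      (latticeTree (RingHom.id F) ϖ !![(0 : F), 1; -1, 0]).Adj M N := by
  refine ⟨fun h => ?_, latticeTree_adj_glVertexAct hϖ g⟩
  have h' := latticeTree_adj_glVertexAct hϖ g⁻¹ h
  rwa [← glVertexAct_mul, ← glVertexAct_mul, inv_mul_cancel, glVertexAct_one, glVertexAct_one] at h'

/-! ## §2 `glTreeIso g : X ≃g X` and `glTreeHom : GL₂(F) →* (X ≃g X)` -/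

/-- **`g` AS A GRAPH AUTOMORPHISM of the tree of `SL₂(F)`**: `M ↦ g · M` with inverse `M ↦ g⁻¹ · M`. [cite: Serre1980Trees, Ch. II §1.2–§1.3] -/
def glTreeIso (g : GL (Fin 2) F) :
    latticeTree (RingHom.id F) ϖ !![(0 : F), 1; -1, 0] ≃g latticeTree (RingHom.id F) ϖ !![(0 : F), 1; -1, 0] where
  toFun := glVertexAct hϖ g
  invFun := glVertexAct hϖ g⁻¹
  left_inv M := by
    show glVertexAct hϖ g⁻¹ (glVertexAct hϖ g M) = M
    rw [← glVertexAct_mul, inv_mul_cancel, glVertexAct_one]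
  right_inv M := by
    show glVertexAct hϖ g (glVertexAct hϖ g⁻¹ M) = M
    rw [← glVertexAct_mul, mul_inv_cancel, glVertexAct_one]
  map_rel_iff' := by
    intro M N
    exact latticeTree_adj_glVertexAct_iff hϖ g M N

/-- `glTreeIso g M = g · M`. [cite: Serre1980Trees, Ch. II §1.2–§1.3] -/
@[simp] theorem glTreeIso_apply (g : GL (Fin 2) F)
    (M : {M : Submodule 𝒪[F] (Fin 2 → F) // IsSpecialLattice (RingHom.id F) ϖ !![(0 : F), 1; -1, 0] M}) :
    glTreeIso hϖ g M = glVertexAct hϖ g M := rfl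

/-- **THE HOMOMORPHISM `GL₂(F) →* Aut(X)`** (`Aut(X) = X ≃g X` with Mathlib's `RelIso` group structure, `(e₁ * e₂) x = e₁ (e₂ x)`).
[cite: Serre1980Trees, Ch. II §1.2–§1.3] [cite: Kottwitz1988, §2] -/
def glTreeHom : GL (Fin 2) F →* (latticeTree (RingHom.id F) ϖ !![(0 : F), 1; -1, 0] ≃g latticeTree (RingHom.id F) ϖ !![(0 : F), 1; -1, 0]) where
  toFun := glTreeIso hϖ
  map_one' := RelIso.ext fun M => glVertexAct_one hϖ M
  map_mul' g g' := RelIso.ext fun M => glVertexAct_mul hϖ g g' M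

/-- `glTreeHom g M = g · M`. [cite: Serre1980Trees, Ch. II §1.2–§1.3] -/
@[simp] theorem glTreeHom_apply (g : GL (Fin 2) F)
    (M : {M : Submodule 𝒪[F] (Fin 2 → F) // IsSpecialLattice (RingHom.id F) ϖ !![(0 : F), 1; -1, 0] M}) :
    glTreeHom hϖ g M = glVertexAct hϖ g M := rfl

/-- `glTreeHom g = glTreeIso g`. [cite: Serre1980Trees, Ch. II §1.2–§1.3] -/
theorem glTreeHom_eq_glTreeIso (g : GL (Fin 2) F) : glTreeHom hϖ g = glTreeIso hϖ g := rfl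

/-- **THE CENTRE ACTS TRIVIALLY**: `glTreeHom ((c · 1) g) = glTreeHom g` — the action factors through `PGL₂(F)`. [cite: Serre1980Trees, Ch. II §1.2] -/
theorem glTreeHom_scalar_mul (c : Fˣ) (g : GL (Fin 2) F) :
    glTreeHom hϖ (c.map ((Matrix.scalar (Fin 2) : F →+* Matrix (Fin 2) (Fin 2) F) : F →* Matrix (Fin 2) (Fin 2) F) * g) = glTreeHom hϖ g :=
  RelIso.ext fun M => glVertexAct_scalar_mul hϖ c g M

/-- `glTreeHom (c · 1) = 1`. [cite: Serre1980Trees, Ch. II §1.2] -/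
theorem glTreeHom_scalar (c : Fˣ) :
    glTreeHom hϖ (c.map ((Matrix.scalar (Fin 2) : F →+* Matrix (Fin 2) (Fin 2) F) : F →* Matrix (Fin 2) (Fin 2) F)) = 1 := by
  rw [← mul_one (c.map _), glTreeHom_scalar_mul, map_one]

end Literature.NumberTheory.Automorphic.HermitianLatticeTree

end
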